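import Summits.NavierStokesRegularity.NavierStokesRegularity.Theorems.StrainDoorsLocalNewtonFloatingDefs
import HarnessLib

/-!
# StrainDoorsLocalNewtonFloating — door D8♮ «FloatingLocalNewtonParityDoor»: D8 with a shell that FLOATS above a floor

Door D8 (`Theorems/StrainDoorsLocalNewton`, ROUND-45, closed by name in `Theorems/StrainDoorsLocalNewtonB3`) fixes the shell
`(r₀,r₁)` of the pressure-free local near feed once and for all. Here the shell is allowed to FLOAT: at each charged almost strain
maximiser `(t,x,e)` SOME dilation `γ ≥ γ₀` of the reference shell may be used (door D8♮, `FloatingLocalNewtonParityDoor`; `γ ≡ 1`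
is D8, `localNewtonParityDoor_of_floating`). The price is the SCALE DEPENDENCE of the one constant of atom B3: the engine hypothesis
`HessSmoothingDilateBound` (the LEAD S-door's R48 pre-typing text «B3Scaling» (s2): `|∫ λ^{γ}_ee(z)·ϖ(v)(x−z) dz| ≤
C(r₀,r₁)·(γ⁻⁵∫‖v‖² + γ⁻³∫|∇v|²_F)`), under which ONE budget `b(t) = C(γ₀⁻⁵ + γ₀⁻³)(‖u(0)‖₂² + ‖∇u(t)‖₂²)` pays the smoothing
term of EVERY shell above the floor (plate B♮ `FloatingSmoothingBudget`, `floatingSmoothingBudget_of_dilate`: the tree's a.e.-gauge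
engine `le_of_gauge_ae`, B1/B2/B4 at the dilated scales, A3′/A3⁺/A3a), and the door follows over plate R (every `t`, any scales) and
D5 (`floatingLocalNewtonParityDoor_of`, ★★ `floatingLocalNewtonParityDoor_of_dilate`). READING (numbers): the budget density is
`C(γ₀⁻⁵E + γ₀⁻³G(t))`, time-integrable iff the floor `γ₀ > 0`; a window tied to the parabolic core `r(t) ~ √(ν(T−t))` has no floor
and its density `~ (T−t)^{−5/2}` is NOT integrable — the typed location of the supercritical gap (LEAD 2026-08-29T00:56:13Z).
Texts (`HessSmoothingDilateBound`, `FloatingSmoothingBudget`, `FloatingLocalNewtonParityDoor`) in `Theorems/StrainDoorsLocalNewtonFloatingDefs`;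
this file: the kernel-checked compositions. `--supports stmt-NavierStokesRegularity-0056 --as helper` (ns-s29-p2 g5; LEAD S-door plate map R47→R48, t-leg).

HONEST FRAME: a CONDITIONAL continuation criterion (hypothesis = near-feed parity at a floating shell) and kernel-checked
compositions; its one NS-free input beyond the tree is the scaling law `HessSmoothingDilateBound` (taken as a hypothesis here);
items 0056 `NoTypeII`, 10661 and NS regularity are NOT proved; nothing here is a route or a summit statement.
-/

noncomputable section

open MeasureTheory Set Function Filter Metric Real InnerProductSpace
open _root_.Topology
open scoped ENNReal NNReal RealInnerProductSpace ContDiff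
open Literature.Analysis Literature.Analysis.FluidPDE

set_option linter.dupNamespace false

namespace Summit.NavierStokesRegularity.NavierStokesRegularity.Theorems.StrainDoors

/-! ## §2 Compositions -/

/-- D8♮ from plate R (every `t`, any scales), plate B♮ and D5 (kernel-checked composition; as `localNewtonParityDoor_of` with the
shell read off the hypothesis at each charged point). -/
theorem floatingLocalNewtonParityDoor_of (hR : LocalNewtonSplits) (hB : FloatingSmoothingBudget) (hD5 : BudgetedParityDoor) :
    FloatingLocalNewtonParityDoor := by
  intro ν T t₀ l₀ δ r₀ r₁ γ₀ hν ht₀ hT hl₀ hδ hδ1 hr₀ hr₁ hγ₀ u p hsol hSob hnear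
  obtain ⟨β, Φ, b, hΦ0, hΦ, hfar⟩ := hB ν T t₀ r₀ r₁ γ₀ u p hν ht₀ hT hr₀ hr₁ hγ₀ hsol hSob
  refine hD5 ν T t₀ l₀ δ (β / l₀) (fun t => Φ t / l₀) (fun t => b t / l₀) hν ht₀ hT hl₀.le hδ hδ1
    (by simp [hΦ0]) ?_ u p hsol hSob ?_
  · intro t ht
    obtain ⟨h0, hβ, hd⟩ := hΦ t ht
    exact ⟨div_nonneg h0 hl₀.le, div_le_div_of_nonneg_right hβ hl₀.le, hd.div_const l₀⟩
  · intro t ht x e hax hq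
    have he : ‖e‖ = 1 := hax.1
    have ht' : t ∈ Ico 0 T := ⟨ht₀.trans ht.1, ht.2⟩
    obtain ⟨γ, hγ, hn⟩ := hnear t ht x e hax hq
    have hγpos : 0 < γ := hγ₀.trans_le hγ
    have hsplit := hR ν T u p hν hsol hSob t ht' (γ * r₀) (γ * r₁) (mul_pos hγpos hr₀)
      (mul_lt_mul_of_pos_left hr₁ hγpos) x e
    have hfb := hfar t ht x e he γ hγ
    have h1 : -smoothingTerm (γ * r₀) (γ * r₁) p t x e ≤ b t := le_trans (neg_le_abs _) hfb
    have hb0 : 0 ≤ b t := le_trans (abs_nonneg _) hfb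
    have h2 : b t ≤ b t / l₀ * strainQuad u t x e := by
      rw [div_mul_eq_mul_div, le_div_iff₀ hl₀]
      exact mul_le_mul_of_nonneg_left hq.le hb0
    rw [hsplit]
    linarith

/-- D8♮ from plates R (tree, proved) and B♮ over the tree's D5. -/
theorem floatingLocalNewtonParityDoor_of_budget (hB : FloatingSmoothingBudget) : FloatingLocalNewtonParityDoor :=
  floatingLocalNewtonParityDoor_of localNewtonSplits_holds hB budgetedParityDoor_holds

/-- the dominance link: D8♮ ⇒ D8 (take `γ₀ = 1` and `γ = 1` at every charged point). -/
theorem localNewtonParityDoor_of_floating (h : FloatingLocalNewtonParityDoor) : LocalNewtonParityDoor := by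
  intro ν T t₀ l₀ δ r₀ r₁ hν ht₀ hT hl₀ hδ hδ1 hr₀ hr₁ u p hsol hSob hnear
  refine h ν T t₀ l₀ δ r₀ r₁ 1 hν ht₀ hT hl₀ hδ hδ1 hr₀ hr₁ one_pos u p hsol hSob fun t ht x e hax hq => ?_
  refine ⟨1, le_rfl, ?_⟩
  rw [one_mul, one_mul]
  exact hnear t ht x e hax hq

/-! ## §3 Plate B♮ from the scaling law -/

/-- the scale factors are monotone: for `0 < γ₀ ≤ γ`, `γ⁻⁵ ≤ γ₀⁻⁵` and `γ⁻³ ≤ γ₀⁻³`. -/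
theorem inv_pow_le_inv_pow_of_le {γ₀ γ : ℝ} (hγ₀ : 0 < γ₀) (hγ : γ₀ ≤ γ) (n : ℕ) : γ⁻¹ ^ n ≤ γ₀⁻¹ ^ n :=
  pow_le_pow_left₀ (inv_nonneg.2 (hγ₀.le.trans hγ)) (inv_anti₀ hγ₀ hγ) n

/-- ★ PLATE B♮ from the scaling law (with B1, B2, B4 at the dilated scales, the a.e. gauge, A3′ `energyNonIncreasing_holds`,
A3⁺ `dissipationBudget_holds`, A3a `gradNormSqContinuousOn_holds`): ONE budget `C(γ₀⁻⁵ + γ₀⁻³)(‖u(0)‖₂²(t − t₀) + Φ_G(t))`. -/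
theorem floatingSmoothingBudget_of_dilate (hS : HessSmoothingDilateBound) : FloatingSmoothingBudget := by
  intro ν T t₀ r₀ r₁ γ₀ u p hν ht₀ hT hr₀ hr₁ hγ₀ hsol hSob
  obtain ⟨C, hC0, hC⟩ := hS r₀ r₁ hr₀ hr₁
  obtain ⟨βg, Φg, hΦg0, hΦg⟩ := dissipationBudget_holds ν T t₀ u p hν ht₀ hT hsol hSob
  set K : ℝ := ∫ y, ‖u 0 y‖ ^ 2 with hK
  have hK0 : 0 ≤ K := integral_nonneg fun _ => by positivity
  set C₀ : ℝ := C * (γ₀⁻¹ ^ 5 + γ₀⁻¹ ^ 3) with hC₀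
  have hC₀0 : 0 ≤ C₀ := mul_nonneg hC0 (by positivity)
  refine ⟨C₀ * (K * T + βg), fun t => C₀ * (K * (t - t₀) + Φg t), fun t => C₀ * (K + VectorCalculus.gradNormSq (u t)),
    by simp [hΦg0], fun t ht => ?_, fun t ht x e he γ hγ => ?_⟩
  · obtain ⟨hΦ0, hΦβ, hΦd⟩ := hΦg t ht
    refine ⟨mul_nonneg hC₀0 (add_nonneg (mul_nonneg hK0 (by linarith [ht.1])) hΦ0),
      mul_le_mul_of_nonneg_left (add_le_add (mul_le_mul_of_nonneg_left (by linarith [ht.2]) hK0) hΦβ) hC₀0, ?_⟩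
    have hd : HasDerivAt (fun t => K * (t - t₀) + Φg t) (K * 1 + VectorCalculus.gradNormSq (u t)) t :=
      (((hasDerivAt_id t).sub_const t₀).const_mul K).add hΦd
    simpa using hd.const_mul C₀
  · have ht' : t ∈ Ico 0 T := ⟨ht₀.trans ht.1, ht.2⟩
    have hγpos : 0 < γ := hγ₀.trans_le hγ
    have hs₀ : 0 < γ * r₀ := mul_pos hγpos hr₀
    have hs₁ : γ * r₀ < γ * r₁ := mul_lt_mul_of_pos_left hr₁ hγpos
    -- continuity of both sides in `t`
    have hF : ContinuousOn (fun τ => |smoothingTerm (γ * r₀) (γ * r₁) p τ x e|) (Ico 0 T) :=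
      (smoothingTermContinuousInTime_holds ν T u p hν hsol hSob (γ * r₀) (γ * r₁) hs₀ hs₁ x e).abs
    have hG : ContinuousOn (fun τ => C₀ * (K + VectorCalculus.gradNormSq (u τ))) (Ico 0 T) :=
      continuousOn_const.mul (continuousOn_const.add (gradNormSqContinuousOn_holds ν T u p hν hsol hSob))
    refine le_of_gauge_ae hν hsol hSob _ _ hF hG (fun τ hτ Cτ hg => ?_) ht'
    -- at a gauge time: IBP to pressure level, kill the constant, apply the scaling law, bound the energy by `K`
    have hP1 : ContDiff ℝ 1 (p τ) := contDiff_infty.1 (hsol.smooth_pressure.contDiff_slice hτ) 1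
    have hϖc : Continuous (normalisedPressure (u τ)) := by
      have : normalisedPressure (u τ) = fun y => p τ y - Cτ := funext fun y => by rw [hg y]; ring
      rw [this]; exact hP1.continuous.sub continuous_const
    have hkc : Continuous (smoothingHessKernel (γ * r₀) (γ * r₁) e) := continuous_smoothingHessKernel hs₀ hs₁ e
    have hks : HasCompactSupport (smoothingHessKernel (γ * r₀) (γ * r₁) e) :=
      (hasCompactSupport_fderiv_newtonFarLaplacian_apply hs₀ hs₁ e).fderiv (𝕜 := ℝ) |>.mono fun z hz h0 =>
        hz (show fderiv ℝ (fun w => fderiv ℝ (newtonFarLaplacian (γ * r₀) (γ * r₁)) w e) z e = 0 by rw [h0]; rfl)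
    have hint1 : Integrable fun z => smoothingHessKernel (γ * r₀) (γ * r₁) e z * normalisedPressure (u τ) (x - z) :=
      (hkc.mul (hϖc.comp (continuous_const.sub continuous_id))).integrable_of_hasCompactSupport hks.mul_right
    have hint2 : Integrable fun z => smoothingHessKernel (γ * r₀) (γ * r₁) e z * Cτ :=
      (hkc.integrable_of_hasCompactSupport hks).mul_const _
    have hsplit : smoothingTerm (γ * r₀) (γ * r₁) p τ x e =
        ∫ z, smoothingHessKernel (γ * r₀) (γ * r₁) e z * normalisedPressure (u τ) (x - z) := by
      rw [smoothingTerm_eq_integral_hessKernel hs₀ hs₁ hP1 x e]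
      have hpt : (fun z => smoothingHessKernel (γ * r₀) (γ * r₁) e z * p τ (x - z)) =
          fun z => smoothingHessKernel (γ * r₀) (γ * r₁) e z * normalisedPressure (u τ) (x - z) +
            smoothingHessKernel (γ * r₀) (γ * r₁) e z * Cτ := by
        funext z; rw [hg (x - z)]; ring
      rw [hpt, integral_add hint1 hint2, integral_mul_const, integral_smoothingHessKernel hs₀ hs₁ e, zero_mul, add_zero]
    have hfin : ∀ n : ℕ, ∫⁻ y, ‖iteratedFDeriv ℝ n (u τ) y‖ₑ ^ 2 < ⊤ := fun n => by
      obtain ⟨T'', hτT'', hT''T⟩ := exists_between hτ.2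
      obtain ⟨C', hC'⟩ := hSob T'' hT''T n
      exact lt_of_le_of_lt (hC' τ ⟨hτ.1, hτT''.le⟩) ENNReal.coe_lt_top
    have hB := hC γ hγpos (u τ) (hsol.contDiff_velocity hτ) hfin x e he
    have hE : ∫ y, ‖u τ y‖ ^ 2 ≤ K := by
      have h := energyNonIncreasing_holds ν T u p hν hsol hSob 0 τ le_rfl hτ.1 hτ.2
      unfold VectorCalculus.kineticEnergy at h
      rw [hK]; linarith
    have hE0 : 0 ≤ ∫ y, ‖u τ y‖ ^ 2 := integral_nonneg fun _ => by positivity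
    have hG0 : 0 ≤ VectorCalculus.gradNormSq (u τ) := integral_nonneg fun _ => frobeniusNormSq_nonneg _
    have h5 : γ⁻¹ ^ 5 ≤ γ₀⁻¹ ^ 5 := inv_pow_le_inv_pow_of_le hγ₀ hγ 5
    have h3 : γ⁻¹ ^ 3 ≤ γ₀⁻¹ ^ 3 := inv_pow_le_inv_pow_of_le hγ₀ hγ 3
    have h50 : 0 ≤ γ₀⁻¹ ^ 5 := by positivity
    have h30 : 0 ≤ γ₀⁻¹ ^ 3 := by positivity
    rw [hsplit]
    calc |∫ z, smoothingHessKernel (γ * r₀) (γ * r₁) e z * normalisedPressure (u τ) (x - z)|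
        ≤ C * (γ⁻¹ ^ 5 * (∫ y, ‖u τ y‖ ^ 2) + γ⁻¹ ^ 3 * VectorCalculus.gradNormSq (u τ)) := hB
      _ ≤ C * (γ₀⁻¹ ^ 5 * K + γ₀⁻¹ ^ 3 * VectorCalculus.gradNormSq (u τ)) := by
          refine mul_le_mul_of_nonneg_left (add_le_add ?_ ?_) hC0
          · exact mul_le_mul h5 hE hE0 h50
          · exact mul_le_mul_of_nonneg_right h3 hG0
      _ ≤ C₀ * (K + VectorCalculus.gradNormSq (u τ)) := by
          rw [hC₀]
          nlinarith [mul_nonneg h30 hK0, mul_nonneg h50 hG0]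

/-- ★★ D8♮ RESTS ON THE SCALING LAW ALONE: `HessSmoothingDilateBound → FloatingLocalNewtonParityDoor`. -/
theorem floatingLocalNewtonParityDoor_of_dilate (hS : HessSmoothingDilateBound) : FloatingLocalNewtonParityDoor :=
  floatingLocalNewtonParityDoor_of_budget (floatingSmoothingBudget_of_dilate hS)

/-- sanity: the scaling law at `γ = 1` is atom B3 (so the engine hypothesis is at least as strong as what D8 used). -/
theorem hessSmoothingEnergyBound_of_dilate (hS : HessSmoothingDilateBound) : HessSmoothingEnergyBound := by
  intro r₀ r₁ hr₀ hr₁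
  obtain ⟨C, hC0, hC⟩ := hS r₀ r₁ hr₀ hr₁
  refine ⟨C, hC0, fun v hv hH x e he => ?_⟩
  have h := hC 1 one_pos v hv hH x e he
  simpa only [one_mul, inv_one, one_pow] using h

end Summit.NavierStokesRegularity.NavierStokesRegularity.Theorems.StrainDoors

end
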